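import Summits.NavierStokesRegularity.NavierStokesRegularity.Theorems.EulerZoomLiouvillePowerGaugeEulerLiouvilleBackwardTools
import Summits.NavierStokesRegularity.NavierStokesRegularity.Theorems.EulerZoomLiouvillePowerGaugeEulerLiouvilleTimePeriodicTools
import Literature.Analysis.FluidPDE.CKNInterpolationEstimate
import HarnessLib

/-!
# Backward vanishing of the power-gauged ancient Euler class (route `EulerZoomLiouville`, crux
# `PowerGaugeEulerLiouville` = stmt-NavierStokesRegularity-19832, line `birth`, STUB 2
# `stub_backwardVanishing`)

Helper file (theorems only).  The birth skeleton of the crux (`Cruxes/PowerGaugeEulerLiouville/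
Lines/birth.lean`) cuts Seregin's open power-gauge Euler Liouville question into `stub_largeRho`
(`ρ > 1/2`, proved), **`stub_backwardVanishing`** (every class member, `ρ > 0`, VANISHES BACKWARD on
fixed balls along density-one sets of times) and the OPEN core `stub_noCollapseFromZero`.  This file
proves the second stub, in the skeleton's hypothesis/conclusion shape (`InClass` / `VanishesBackward`
unfolded): for `(u, p, H, c)` with `H` a weak spatial gradient of `u` on the slab `ℝ³ × (-∞, 0)` and
the gauge `a^{2ρ} A(a) + a^ρ E(a) + a^{2ρ} D(a) ≤ c` at the origin for all `a > 0`, and every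
`R, ε > 0`,

  `|{τ ∈ (-a², 0) : ∫_{B_R} |u(τ)|² > ε}| / a² → 0`  as `a → ∞`   (`vanishesBackward_of_gauge`).

Mechanism.  (E1, Chebyshev in time, `mul_volume_sep_le_setLIntegral_prod` of `…BackwardTools`) the `E`-gauge gives
`∫∫_{Q_a(0)} |H|² ≤ c a^{1-ρ}`, so off a set of times of measure `≤ c a^{1-ρ}/λ_a` one has
`∫_{B_a} |H(τ)|² ≤ λ_a := a^{-(1+ρ)/2}`; (E2, multiscale Poincaré, file `…BackwardPoincare`) for such
a good time — a.e. slice of `u` is `W^{1,2}` with weak gradient `H(τ)`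
(`HasWeakSpatialGradientOn.ae_hasWeakFDerivOn_slice`) — `‖u(τ)‖_{L²(B_R)} ≤ K R λ_a^{1/2} +
‖⨍_{B(0,4ⁿR)} u(τ)‖ |B_R|^{1/2}` with `a/4 < 4ⁿR ≤ a`, and the `A`-gauge `∫_{B_a}|u(τ)|² ≤ c a^{1-2ρ}`
makes the last term `≤ 8 √c R^{3/2} a^{-1-ρ}`; both tend to `0`, so for large `a` no good time is
`ε`-active, and the proportion of bad times is `≤ c a^{-(1+ρ)/2} → 0`.  The suitable-weak-solution
clause of the class (Euler system, local energy inequality, pressure) is NOT used.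

* `vanishesBackward_of_gauge` — the stub with the class unfolded to what is used;
* `stub_backwardVanishing` — verbatim the registered signature `Sig.stub_backwardVanishing` of the
  birth skeleton (with its `InClass` / `VanishesBackward` abbreviations unfolded).

WHAT THIS IS NOT: not NS / Euler regularity and not the crux — the OPEN core `stub_noCollapseFromZero`
(no Euler collapse out of zero for `0 < ρ ≤ 1/2`, containing the Chae–Shvydkoy window) is untouched.
[folklore]
-/

noncomputable section

-- the summit and its single problem share the name `NavierStokesRegularity` (D-0017 nested layout)
set_option linter.dupNamespace false

open MeasureTheory Set Filter Topology Metric Module TopologicalSpace Function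
open scoped NNReal ENNReal

namespace Summit.NavierStokesRegularity.NavierStokesRegularity.Theorems.PowerGaugeEulerLiouville.Backward

open Literature.Analysis Literature.Analysis.FunctionSpaces Literature.Analysis.FluidPDE
open Summit.NavierStokesRegularity.NavierStokesRegularity.Theorems.PowerGaugeEulerLiouville.TimePeriodic
  (setLIntegral_window_le_of_gaugeE)

/-! ## The stub -/

variable {u : ℝ → EuclideanSpace ℝ (Fin 3) → EuclideanSpace ℝ (Fin 3)}
  {H : ℝ → EuclideanSpace ℝ (Fin 3) → EuclideanSpace ℝ (Fin 3) →L[ℝ] EuclideanSpace ℝ (Fin 3)}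

/-- **Backward vanishing under the power gauge** (the content of `stub_backwardVanishing`).  Let `H`
be a weak spatial gradient of `u` on the slab `ℝ³ × (-∞, 0)`, and suppose the `A`- and `E`-gauges
`a^{2ρ} A(u; Q_a(0)) ≤ c`, `a^ρ E(H; Q_a(0)) ≤ c` for all `a > 0`, with `ρ > 0`.  Then for every
`R, ε > 0` the proportion of times `τ ∈ (-a², 0)` at which `∫_{B(0,R)} |u(τ)|² > ε` tends to `0` as
`a → ∞`.  See the file docstring for the mechanism (Chebyshev in time + multiscale Poincaré +
`A`-gauge on the top mean). [folklore] -/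
theorem vanishesBackward_of_gauge {ρ : ℝ} (hρ : 0 < ρ) {c : ℝ≥0}
    (hH : HasWeakSpatialGradientOn (slab (EuclideanSpace ℝ (Fin 3)) (Set.Iio 0) isOpen_Iio) u H)
    (hA : ∀ a : ℝ, 0 < a →
      ENNReal.ofReal (a ^ (2 * ρ)) * cknA a (0 : ℝ × EuclideanSpace ℝ (Fin 3)) u ≤ (c : ℝ≥0∞))
    (hE : ∀ a : ℝ, 0 < a →
      ENNReal.ofReal (a ^ ρ) * cknE a (0 : ℝ × EuclideanSpace ℝ (Fin 3)) H ≤ (c : ℝ≥0∞))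
    {R ε : ℝ} (hR : 0 < R) (hε : 0 < ε) :
    Tendsto (fun a : ℝ =>
        volume {τ : ℝ | τ ∈ Set.Ioo (-(a ^ 2)) 0 ∧
            ENNReal.ofReal ε < ∫⁻ y in ball (0 : EuclideanSpace ℝ (Fin 3)) R, ‖u τ y‖ₑ ^ 2} /
          ENNReal.ofReal (a ^ 2))
      atTop (𝓝 0) := by
  obtain ⟨K, hKtop, hK⟩ := exists_eLpNorm_ball_le_multiscale
  set W : ℝ≥0∞ := volume (ball (0 : EuclideanSpace ℝ (Fin 3)) R) ^ (1 / 2 : ℝ) with hWdef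
  set σ : ℝ := (1 + ρ) / 2 with hσ
  have hσpos : 0 < σ := by positivity
  -- ## good slices: a.e. `τ < 0`, `H(τ)` is a weak derivative of `u(τ)` on `ℝ³`
  have hslice : ∀ᵐ τ ∂(volume.restrict (Set.Iio (0 : ℝ))),
      HasWeakFDerivOn (⊤ : Opens (EuclideanSpace ℝ (Fin 3))) volume (u τ) (H τ) := by
    have hcov : Set.Iio (0 : ℝ) = ⋃ N : ℕ, Set.Ioo (-((N : ℝ) + 1)) 0 := by
      ext τ
      simp only [mem_Iio, mem_iUnion, mem_Ioo]
      constructor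
      · intro hτ
        obtain ⟨N, hN⟩ := exists_nat_gt (-τ)
        exact ⟨N, by linarith, hτ⟩
      · rintro ⟨N, -, hτ⟩; exact hτ
    rw [hcov, ae_restrict_iUnion_iff]
    intro N
    have hmono : slab (EuclideanSpace ℝ (Fin 3)) (Set.Ioo (-((N : ℝ) + 1)) 0) isOpen_Ioo ≤
        slab (EuclideanSpace ℝ (Fin 3)) (Set.Iio 0) isOpen_Iio := slab_mono Ioo_subset_Iio_self
    exact (hH.mono hmono).ae_hasWeakFDerivOn_slice (Ω := ⊤)
  -- the null set of bad slices
  set G : Set ℝ := {τ | HasWeakFDerivOn (⊤ : Opens (EuclideanSpace ℝ (Fin 3))) volume (u τ) (H τ)} with hG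
  have hGnull : volume (Gᶜ ∩ Set.Iio 0) = 0 := by
    have h := hslice
    rw [ae_iff, Measure.restrict_apply' measurableSet_Iio] at h
    simpa only [hG, Set.compl_setOf] using h
  -- ## measurability of the dissipation density on cylinders inside the slab
  set F : ℝ × EuclideanSpace ℝ (Fin 3) → ℝ≥0∞ := fun q => ENNReal.ofReal (frobeniusNormSq (H q.1 q.2)) with hF
  have hFm : ∀ b : ℝ, AEMeasurable F (volume.restrict (Set.Ioo (-(b ^ 2)) 0 ×ˢ ball (0 : EuclideanSpace ℝ (Fin 3)) b)) := by
    intro b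
    have hsub : Set.Ioo (-(b ^ 2)) 0 ×ˢ ball (0 : EuclideanSpace ℝ (Fin 3)) b ⊆
        ((slab (EuclideanSpace ℝ (Fin 3)) (Set.Iio 0) isOpen_Iio : Opens _) : Set (ℝ × EuclideanSpace ℝ (Fin 3))) := by
      rw [coe_slab]
      exact prod_mono Ioo_subset_Iio_self (subset_univ _)
    have hsm : AEStronglyMeasurable (uncurry H)
        (volume.restrict (Set.Ioo (-(b ^ 2)) 0 ×ˢ ball (0 : EuclideanSpace ℝ (Fin 3)) b)) :=
      hH.locallyIntegrableOn_grad.aestronglyMeasurable.mono_measure (Measure.restrict_mono hsub le_rfl)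
    exact ((ENNReal.continuous_ofReal.comp continuous_frobeniusNormSq').comp_aestronglyMeasurable
      hsm).aemeasurable
  -- ## the rate bound and the two vanishing error terms
  set bound : ℝ → ℝ≥0∞ := fun a =>
    K * ENNReal.ofReal R * ENNReal.ofReal (Real.sqrt (a ^ (-σ))) +
      ENNReal.ofReal (Real.sqrt ((c : ℝ) * R) * R / a) with hbound
  have hbound0 : Tendsto bound atTop (𝓝 0) := by
    have h1 : Tendsto (fun a : ℝ => Real.sqrt (a ^ (-σ))) atTop (𝓝 0) := by
      have h := (Real.continuous_sqrt.tendsto 0).comp (tendsto_rpow_neg_atTop hσpos)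
      rwa [Function.comp_def, Real.sqrt_zero] at h
    have h1' : Tendsto (fun a : ℝ => K * ENNReal.ofReal R * ENNReal.ofReal (Real.sqrt (a ^ (-σ)))) atTop (𝓝 0) := by
      have h := ENNReal.tendsto_ofReal h1
      rw [ENNReal.ofReal_zero] at h
      have h' := ENNReal.Tendsto.const_mul (a := K * ENNReal.ofReal R) h
        (Or.inr (ENNReal.mul_ne_top hKtop ENNReal.ofReal_ne_top))
      simpa using h'
    have h2 : Tendsto (fun a : ℝ => ENNReal.ofReal (Real.sqrt ((c : ℝ) * R) * R / a)) atTop (𝓝 0) := by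
      have h := ENNReal.tendsto_ofReal
        ((tendsto_const_nhds (x := Real.sqrt ((c : ℝ) * R) * R)).div_atTop tendsto_id)
      rwa [ENNReal.ofReal_zero] at h
    have h := h1'.add h2
    simpa [hbound] using h
  have hrate : Tendsto (fun a : ℝ => ENNReal.ofReal (16 * (c : ℝ) * a ^ (-σ))) atTop (𝓝 0) := by
    have h1 : Tendsto (fun a : ℝ => 16 * (c : ℝ) * a ^ (-σ)) atTop (𝓝 0) := by
      have h := (tendsto_rpow_neg_atTop hσpos).const_mul (16 * (c : ℝ))
      simpa using h
    have h := ENNReal.tendsto_ofReal h1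
    rwa [ENNReal.ofReal_zero] at h
  have hsqrtε : (0 : ℝ≥0∞) < ENNReal.ofReal (Real.sqrt ε) := ENNReal.ofReal_pos.2 (Real.sqrt_pos.2 hε)
  refine tendsto_of_tendsto_of_tendsto_of_le_of_le' tendsto_const_nhds hrate
    (Eventually.of_forall fun _ => zero_le) ?_
  filter_upwards [eventually_ge_atTop (max R 1), hbound0.eventually (Iio_mem_nhds hsqrtε)] with a haR hba
  have ha1 : 1 ≤ a := le_trans (le_max_right _ _) haR
  have ha0 : 0 < a := lt_of_lt_of_le one_pos ha1
  have haR' : R ≤ a := le_trans (le_max_left _ _) haR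
  -- ## the top scale `b = 4^{n+1} R ∈ (a, 4a]`
  obtain ⟨n, hn1, hn2⟩ := exists_nat_pow_near (x := a / R) ((one_le_div hR).2 haR') (by norm_num : (1 : ℝ) < 4)
  set b : ℝ := 4 ^ (n + 1) * R with hb
  have hab : a < b := by
    have h := (div_lt_iff₀ hR).1 hn2
    simpa [hb] using h
  have hb4 : b ≤ 4 * a := by
    have h := (le_div_iff₀ hR).1 hn1
    have : (4 : ℝ) ^ (n + 1) * R = 4 * (4 ^ n * R) := by ring
    rw [hb, this]
    linarith
  have hb0 : 0 < b := ha0.trans hab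
  have hb1 : 1 ≤ b := ha1.trans hab.le
  -- real quantities
  set l : ℝ := b ^ (-σ) with hl
  have hl0 : 0 < l := Real.rpow_pos_of_pos hb0 _
  -- ## (E1) Chebyshev at scale `b`
  set e : ℝ → ℝ≥0∞ := fun τ => ∫⁻ y in ball (0 : EuclideanSpace ℝ (Fin 3)) b, F (τ, y) with he
  set S : Set ℝ := {τ ∈ Set.Ioo (-(a ^ 2)) 0 | ENNReal.ofReal l ≤ e τ} with hS
  have hSb : S ⊆ {τ ∈ Set.Ioo (-(b ^ 2)) 0 | ENNReal.ofReal l ≤ e τ} := by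
    intro τ hτ
    refine ⟨⟨?_, hτ.1.2⟩, hτ.2⟩
    have : a ^ 2 < b ^ 2 := by gcongr
    linarith [hτ.1.1]
  have hcheb : ENNReal.ofReal l * volume S ≤ ENNReal.ofReal ((c : ℝ) * b ^ (1 - ρ)) := by
    calc ENNReal.ofReal l * volume S
        ≤ ENNReal.ofReal l * volume {τ ∈ Set.Ioo (-(b ^ 2)) 0 | ENNReal.ofReal l ≤ e τ} := by
          gcongr
      _ ≤ ∫⁻ q in Set.Ioo (-(b ^ 2)) 0 ×ˢ ball (0 : EuclideanSpace ℝ (Fin 3)) b, F q :=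
          mul_volume_sep_le_setLIntegral_prod (hFm b) _
      _ ≤ ENNReal.ofReal ((c : ℝ) * b ^ (1 - ρ)) :=
          setLIntegral_window_le_of_gaugeE hb0 le_rfl le_rfl (hE b hb0)
  have hvolS : volume S / ENNReal.ofReal (a ^ 2) ≤ ENNReal.ofReal (16 * (c : ℝ) * a ^ (-σ)) := by
    have h1 : volume S ≤ ENNReal.ofReal ((c : ℝ) * b ^ (1 - ρ)) / ENNReal.ofReal l := by
      rw [ENNReal.le_div_iff_mul_le (Or.inl (ENNReal.ofReal_pos.2 hl0).ne') (Or.inl ENNReal.ofReal_ne_top),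
        mul_comm]
      exact hcheb
    have ha2 : 0 < a ^ 2 := by positivity
    calc volume S / ENNReal.ofReal (a ^ 2)
        ≤ (ENNReal.ofReal ((c : ℝ) * b ^ (1 - ρ)) / ENNReal.ofReal l) / ENNReal.ofReal (a ^ 2) := by
          gcongr
      _ = ENNReal.ofReal ((c : ℝ) * b ^ (1 - ρ) / l / a ^ 2) := by
          rw [ENNReal.ofReal_div_of_pos ha2, ENNReal.ofReal_div_of_pos hl0]
      _ ≤ ENNReal.ofReal (16 * (c : ℝ) * a ^ (-σ)) :=
          ENNReal.ofReal_le_ofReal (by simpa only [hl, hσ] using chebyshev_ratio_le hρ ha1 hab hb4 c.coe_nonneg)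
  -- ## good times are not `ε`-active
  have hgood : ∀ τ ∈ Set.Ioo (-(a ^ 2)) 0, τ ∈ G → e τ < ENNReal.ofReal l →
      ∫⁻ y in ball (0 : EuclideanSpace ℝ (Fin 3)) R, ‖u τ y‖ₑ ^ 2 ≤ ENNReal.ofReal ε := by
    intro τ hτ hGτ heτ
    have hτb : τ ∈ Set.Ioo (-(b ^ 2)) 0 := by
      refine ⟨?_, hτ.2⟩
      have : a ^ 2 < b ^ 2 := by gcongr
      linarith [hτ.1]
    have hWτ : HasWeakFDerivOn (⊤ : Opens (EuclideanSpace ℝ (Fin 3))) volume (u τ) (H τ) := hGτ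
    -- the slice and its gradient on the top ball `B(0, b)`
    have hWb : HasWeakFDerivOn (⟨ball (0 : EuclideanSpace ℝ (Fin 3)) (4 ^ (n + 1) * R), isOpen_ball⟩ :
        Opens (EuclideanSpace ℝ (Fin 3))) volume (u τ) (H τ) :=
      HasWeakFDerivOn.mono_set_holds hWτ le_top
    have hIA : ∫⁻ y in ball (0 : EuclideanSpace ℝ (Fin 3)) b, ‖u τ y‖ₑ ^ 2 ≤
        ENNReal.ofReal ((c : ℝ) * b ^ (1 - 2 * ρ)) := lintegral_ball_le_of_gaugeA hb0 (hA b hb0) hτb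
    have hfm : AEStronglyMeasurable (u τ) (volume.restrict (ball (0 : EuclideanSpace ℝ (Fin 3)) b)) :=
      hWτ.locallyIntegrableOn.aestronglyMeasurable.mono_measure
        (Measure.restrict_mono (subset_univ _) le_rfl)
    have hgm : AEStronglyMeasurable (H τ) (volume.restrict (ball (0 : EuclideanSpace ℝ (Fin 3)) b)) :=
      hWτ.locallyIntegrableOn_deriv.aestronglyMeasurable.mono_measure
        (Measure.restrict_mono (subset_univ _) le_rfl)
    have hf2 : eLpNorm (u τ) 2 (volume.restrict (ball (0 : EuclideanSpace ℝ (Fin 3)) b)) ≤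
        ENNReal.ofReal (Real.sqrt ((c : ℝ) * b ^ (1 - 2 * ρ))) := by
      rw [eLpNorm_two_eq_sqrt]
      calc (∫⁻ y in ball (0 : EuclideanSpace ℝ (Fin 3)) b, ‖u τ y‖ₑ ^ 2) ^ (1 / 2 : ℝ)
          ≤ (ENNReal.ofReal ((c : ℝ) * b ^ (1 - 2 * ρ))) ^ (1 / 2 : ℝ) := by gcongr
        _ = ENNReal.ofReal (Real.sqrt ((c : ℝ) * b ^ (1 - 2 * ρ))) := by
            rw [ENNReal.ofReal_rpow_of_nonneg (by positivity) (by norm_num), Real.sqrt_eq_rpow]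
    have hg2 : eLpNorm (H τ) 2 (volume.restrict (ball (0 : EuclideanSpace ℝ (Fin 3)) b)) ≤
        ENNReal.ofReal (Real.sqrt l) := by
      calc eLpNorm (H τ) 2 (volume.restrict (ball (0 : EuclideanSpace ℝ (Fin 3)) b))
          ≤ (∫⁻ y in ball (0 : EuclideanSpace ℝ (Fin 3)) b, F (τ, y)) ^ (1 / 2 : ℝ) :=
            eLpNorm_two_le_of_frobenius (H τ)
        _ ≤ (ENNReal.ofReal l) ^ (1 / 2 : ℝ) := by have heτ' := heτ.le; gcongr
        _ = ENNReal.ofReal (Real.sqrt l) := by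
            rw [ENNReal.ofReal_rpow_of_nonneg hl0.le (by norm_num), Real.sqrt_eq_rpow]
    have hfM : MemLp (u τ) 2 (volume.restrict (ball (0 : EuclideanSpace ℝ (Fin 3)) (4 ^ (n + 1) * R))) :=
      ⟨hfm, lt_of_le_of_lt hf2 ENNReal.ofReal_lt_top⟩
    have hgM : MemLp (H τ) 2 (volume.restrict (ball (0 : EuclideanSpace ℝ (Fin 3)) (4 ^ (n + 1) * R))) :=
      ⟨hgm, lt_of_le_of_lt hg2 ENNReal.ofReal_lt_top⟩
    -- multiscale Poincaré
    have hMS := hK 0 R hR (n + 1) (u τ) (H τ) hfM hgM hWb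
    -- the top mean: Jensen + `A`-gauge, `|B_b|^{1/2} = 8^{n+1} |B_R|^{1/2}`
    have hmean : ‖⨍ y in ball (0 : EuclideanSpace ℝ (Fin 3)) (4 ^ (n + 1) * R), u τ y‖ₑ * W ≤
        ENNReal.ofReal (Real.sqrt ((c : ℝ) * R) * R / a) := by
      have hJ := FunctionSpaces.enorm_setAverage_mul_rpow_le (μ := volume)
        (s := ball (0 : EuclideanSpace ℝ (Fin 3)) b) measure_ball_lt_top.ne (p := 2) (by norm_num) hfm
      have e2 : (1 / (2 : ℝ≥0∞).toReal : ℝ) = 1 / 2 := by norm_num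
      rw [e2, show ball (0 : EuclideanSpace ℝ (Fin 3)) b = ball 0 (4 ^ (n + 1) * R) from rfl,
        volume_ball_pow_four_rpow_half 0 hR (n + 1)] at hJ
      -- hJ : ‖m‖ₑ * (8^{n+1} * W) ≤ eLpNorm (u τ) 2 (vol|B_b)
      have h1 : ‖⨍ y in ball (0 : EuclideanSpace ℝ (Fin 3)) (4 ^ (n + 1) * R), u τ y‖ₑ * W * 8 ^ (n + 1) ≤
          ENNReal.ofReal (Real.sqrt ((c : ℝ) * b ^ (1 - 2 * ρ))) := by
        calc _ = ‖⨍ y in ball (0 : EuclideanSpace ℝ (Fin 3)) (4 ^ (n + 1) * R), u τ y‖ₑ * (8 ^ (n + 1) * W) := by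
              ring
          _ ≤ _ := hJ.trans hf2
      -- `√(c b^{1-2ρ}) ≤ √c · 2^{n+1} · √R` since `b ≥ 1`, `(1-2ρ)/2 ≤ 1/2`, `b = 4^{n+1} R`
      have h2 : Real.sqrt ((c : ℝ) * b ^ (1 - 2 * ρ)) ≤ Real.sqrt (c : ℝ) * 2 ^ (n + 1) * Real.sqrt R := by
        have hb' : b ^ (1 - 2 * ρ) ≤ b ^ (1 : ℝ) :=
          Real.rpow_le_rpow_of_exponent_le hb1 (by linarith)
        rw [Real.rpow_one] at hb'
        calc Real.sqrt ((c : ℝ) * b ^ (1 - 2 * ρ)) ≤ Real.sqrt ((c : ℝ) * b) :=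
              Real.sqrt_le_sqrt (mul_le_mul_of_nonneg_left hb' c.coe_nonneg)
          _ = Real.sqrt (c : ℝ) * 2 ^ (n + 1) * Real.sqrt R := by
              rw [hb, Real.sqrt_mul c.coe_nonneg, Real.sqrt_mul (by positivity),
                show (4 : ℝ) ^ (n + 1) = (2 ^ (n + 1)) ^ 2 by rw [← pow_mul, mul_comm, pow_mul]; norm_num,
                Real.sqrt_sq (by positivity)]
              ring
      have h80 : (8 : ℝ≥0∞) ^ (n + 1) ≠ 0 := pow_ne_zero _ (by norm_num)
      have h8t : (8 : ℝ≥0∞) ^ (n + 1) ≠ ⊤ := ENNReal.pow_ne_top ENNReal.ofNat_ne_top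
      have h3 : ‖⨍ y in ball (0 : EuclideanSpace ℝ (Fin 3)) (4 ^ (n + 1) * R), u τ y‖ₑ * W ≤
          ENNReal.ofReal (Real.sqrt (c : ℝ) * Real.sqrt R) * (2 ^ (n + 1) * ((8 : ℝ≥0∞) ^ (n + 1))⁻¹) := by
        rw [← ENNReal.le_div_iff_mul_le (Or.inl h80) (Or.inl h8t)] at h1
        refine h1.trans ?_
        rw [div_eq_mul_inv, ← mul_assoc]
        gcongr
        refine (ENNReal.ofReal_le_ofReal h2).trans (le_of_eq ?_)
        rw [show Real.sqrt (c : ℝ) * 2 ^ (n + 1) * Real.sqrt R = (Real.sqrt (c : ℝ) * Real.sqrt R) * 2 ^ (n + 1) by ring,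
          ENNReal.ofReal_mul (by positivity), ENNReal.ofReal_pow (by norm_num)]
        norm_num
      rw [two_pow_mul_inv_eight_pow] at h3
      -- `(4^{n+1})⁻¹ ≤ R / a` since `a < 4^{n+1} R`
      have h4 : ((4 : ℝ≥0∞) ^ (n + 1))⁻¹ ≤ ENNReal.ofReal (R / a) := by
        have hq : ((4 : ℝ) ^ (n + 1))⁻¹ ≤ R / a := by
          rw [le_div_iff₀ ha0, inv_mul_le_iff₀ (by positivity)]
          simpa [hb] using hab.le
        calc ((4 : ℝ≥0∞) ^ (n + 1))⁻¹ = ENNReal.ofReal (((4 : ℝ) ^ (n + 1))⁻¹) := by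
              rw [ENNReal.ofReal_inv_of_pos (by positivity), ENNReal.ofReal_pow (by norm_num)]
              norm_num
          _ ≤ ENNReal.ofReal (R / a) := ENNReal.ofReal_le_ofReal hq
      calc ‖⨍ y in ball (0 : EuclideanSpace ℝ (Fin 3)) (4 ^ (n + 1) * R), u τ y‖ₑ * W
          ≤ ENNReal.ofReal (Real.sqrt (c : ℝ) * Real.sqrt R) * ((4 : ℝ≥0∞) ^ (n + 1))⁻¹ := h3
        _ ≤ ENNReal.ofReal (Real.sqrt (c : ℝ) * Real.sqrt R) * ENNReal.ofReal (R / a) := by gcongr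
        _ = ENNReal.ofReal (Real.sqrt ((c : ℝ) * R) * R / a) := by
            rw [← ENNReal.ofReal_mul (by positivity), ← Real.sqrt_mul c.coe_nonneg]
            congr 1
            ring
    -- assemble: `‖u τ‖_{L²(B_R)} ≤ bound a < √ε`
    have hl_le : Real.sqrt l ≤ Real.sqrt (a ^ (-σ)) :=
      Real.sqrt_le_sqrt (Real.rpow_le_rpow_of_nonpos ha0 hab.le (by linarith))
    have hfinal : eLpNorm (u τ) 2 (volume.restrict (ball (0 : EuclideanSpace ℝ (Fin 3)) R)) ≤ bound a := by
      refine hMS.trans ?_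
      simp only [hbound]
      gcongr
      · exact hg2.trans (ENNReal.ofReal_le_ofReal hl_le)
    have hlt : eLpNorm (u τ) 2 (volume.restrict (ball (0 : EuclideanSpace ℝ (Fin 3)) R)) ≤
        ENNReal.ofReal (Real.sqrt ε) := hfinal.trans hba.le
    have hsq := lintegral_enorm_sq_le_of_eLpNorm_le hlt
    rwa [← ENNReal.ofReal_pow (Real.sqrt_nonneg _), Real.sq_sqrt hε.le] at hsq
  -- ## the `ε`-active set lies in `S ∪ (Gᶜ ∩ (-∞,0))`
  have hsubset : {τ : ℝ | τ ∈ Set.Ioo (-(a ^ 2)) 0 ∧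
      ENNReal.ofReal ε < ∫⁻ y in ball (0 : EuclideanSpace ℝ (Fin 3)) R, ‖u τ y‖ₑ ^ 2} ⊆ S ∪ (Gᶜ ∩ Set.Iio 0) := by
    rintro τ ⟨hτ, hact⟩
    by_cases hGτ : τ ∈ G
    · left
      refine ⟨hτ, ?_⟩
      by_contra hlt
      exact absurd hact (not_lt.2 (hgood τ hτ hGτ (not_le.1 hlt)))
    · right
      exact ⟨hGτ, hτ.2⟩
  calc volume {τ : ℝ | τ ∈ Set.Ioo (-(a ^ 2)) 0 ∧
          ENNReal.ofReal ε < ∫⁻ y in ball (0 : EuclideanSpace ℝ (Fin 3)) R, ‖u τ y‖ₑ ^ 2} /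
        ENNReal.ofReal (a ^ 2)
      ≤ volume (S ∪ (Gᶜ ∩ Set.Iio 0)) / ENNReal.ofReal (a ^ 2) := by gcongr
    _ ≤ (volume S + volume (Gᶜ ∩ Set.Iio 0)) / ENNReal.ofReal (a ^ 2) := by
        gcongr; exact measure_union_le _ _
    _ = volume S / ENNReal.ofReal (a ^ 2) := by rw [hGnull, add_zero]
    _ ≤ ENNReal.ofReal (16 * (c : ℝ) * a ^ (-σ)) := hvolS

/-- **STUB 2 of the birth skeleton, in its registered binder shape** (`Sig.stub_backwardVanishing` of
`Cruxes/PowerGaugeEulerLiouville/Lines/birth.lean`, with the reducible `InClass` / `VanishesBackward`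
unfolded): every member of the power-gauged ancient Euler class, `ρ > 0`, vanishes backward on fixed
balls along density-one sets of times.  The suitable-weak-solution clause and the `D`-gauge are NOT used.
[folklore] -/
theorem stub_backwardVanishing :
    ∀ ρ : ℝ, 0 < ρ → ∀ (u : ℝ → EuclideanSpace ℝ (Fin 3) → EuclideanSpace ℝ (Fin 3))
      (p : ℝ → EuclideanSpace ℝ (Fin 3) → ℝ)
      (H : ℝ → EuclideanSpace ℝ (Fin 3) → EuclideanSpace ℝ (Fin 3) →L[ℝ] EuclideanSpace ℝ (Fin 3)) (c : ℝ≥0),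
      (IsSuitableWeakSolutionOn (slab (EuclideanSpace ℝ (Fin 3)) (Set.Iio 0) isOpen_Iio) 0 0 u p ∧
        HasWeakSpatialGradientOn (slab (EuclideanSpace ℝ (Fin 3)) (Set.Iio 0) isOpen_Iio) u H ∧
        (∀ a : ℝ, 0 < a → ENNReal.ofReal (a ^ (2 * ρ)) * cknA a (0 : ℝ × EuclideanSpace ℝ (Fin 3)) u +
          ENNReal.ofReal (a ^ ρ) * cknE a (0 : ℝ × EuclideanSpace ℝ (Fin 3)) H +
          ENNReal.ofReal (a ^ (2 * ρ)) * cknD a (0 : ℝ × EuclideanSpace ℝ (Fin 3)) p ≤ (c : ℝ≥0∞))) →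
      ∀ R ε : ℝ, 0 < R → 0 < ε →
        Tendsto (fun a : ℝ =>
            volume {τ : ℝ | τ ∈ Set.Ioo (-(a ^ 2)) 0 ∧
                ENNReal.ofReal ε < ∫⁻ y in ball (0 : EuclideanSpace ℝ (Fin 3)) R, ‖u τ y‖ₑ ^ 2} /
              ENNReal.ofReal (a ^ 2))
          atTop (𝓝 0) := by
  intro ρ hρ u p H c h R ε hR hε
  obtain ⟨_hsw, hH, hc⟩ := h
  have hA : ∀ a : ℝ, 0 < a →
      ENNReal.ofReal (a ^ (2 * ρ)) * cknA a (0 : ℝ × EuclideanSpace ℝ (Fin 3)) u ≤ (c : ℝ≥0∞) :=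
    fun a ha => le_trans (le_trans le_self_add le_self_add) (hc a ha)
  have hE : ∀ a : ℝ, 0 < a →
      ENNReal.ofReal (a ^ ρ) * cknE a (0 : ℝ × EuclideanSpace ℝ (Fin 3)) H ≤ (c : ℝ≥0∞) :=
    fun a ha => le_trans (le_trans le_add_self le_self_add) (hc a ha)
  exact vanishesBackward_of_gauge hρ hH hA hE hR hε

end Summit.NavierStokesRegularity.NavierStokesRegularity.Theorems.PowerGaugeEulerLiouville.Backward

end
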